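/-
Copyright (c) 2026. Released under Apache 2.0 license as described in the file LICENSE.
-/
import Summits.RiemannHypothesis.RiemannHypothesis.Theorems.LiDirichletKernelPrograms
import Literature.NumberTheory.LFunctions.Xiao2020.Refutation
import Literature.NumberTheory.LFunctions.DirichletLOneTaylorEM
import HarnessLib

/-!
# KERNEL LINEAGE K-χ — soundness I: enclosure lemmas for the list programs

RH-FREE DATA machinery.  bears_on: LADDER-RH L-D (Dirichlet rows).  WHAT THIS IS NOT: nothing here bears on
the truth of RH or GRH.

What the generic programs of `Theorems/LiDirichletKernelPrograms.lean` enclose, part 1: the tabulated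
Euler–Maclaurin coefficients (`emCoeffTable_eq`), complex box lists (`EnclC`, `addLC`, `dotC`, `widenPassC`), and
the logarithm table built from CHECKED factorisations (`logsFromFacs_spec`).  Part 2 (head power sums, fine-scale
Bernoulli coefficients, `progCoeffs_spec`) is `Theorems/LiDirichletKernelProgCoeffs.lean`.  Style and most list
lemmas: `Xiao2020/CertEnclosure.lean`, `Xiao2020/CertTables.lean` (kernel lineage K of the `ζ` table).
-/

set_option linter.dupNamespace false

namespace Summit.RiemannHypothesis.RiemannHypothesis.Theorems.LiDirichletKernel

open Literature.Analysis.ValidatedNumerics Literature.Analysis.ValidatedNumerics.NumericsMP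
open Literature.NumberTheory.LFunctions Literature.NumberTheory.LFunctions.Xiao2020
open Literature.NumberTheory.LFunctions.Xiao2020.CertKernel
open Finset
open scoped Nat

variable {S : ℕ}

/-! ## The tabulated Euler–Maclaurin coefficients -/

/-- The literal table is `ZetaNumerics.emCoeffList 28`. -/
theorem emCoeffTable_eq : emCoeffTable = ZetaNumerics.emCoeffList NUK := by decide +kernel

/-- `emCoeffTable[j+1] = c_{j+1} = B_{2j+2}/(2j+2)!` for `j < 28`. -/
theorem emCoeffTable_getD_succ {j : ℕ} (hj : j < NUK) :
    emCoeffTable.getD (j + 1) 0 = ZetaNumerics.emCoeff (j + 1) := by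
  rw [emCoeffTable_eq]; exact emCoeffList_getD_succ hj

/-! ## Complex box lists -/

/-- `EnclC S f L`: the `i`-th complex box of `L` contains `f i`. -/
def EnclC (S : ℕ) (f : ℕ → ℂ) : List MC → Prop
  | [] => True
  | Z :: L => MC.mem S (f 0) Z ∧ EnclC S (fun i ↦ f (i + 1)) L

/-- The empty list encloses anything. -/
@[simp] theorem enclC_nil {f : ℕ → ℂ} : EnclC S f [] := trivial

/-- The zero complex box contains `0`. -/
theorem mem_zeroC (S : ℕ) : MC.mem S 0 zeroC := by
  constructor <;> simp [zeroC, mem_zeroI]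

/-- `EnclC` entrywise. -/
theorem enclC_iff_getD {f : ℕ → ℂ} {L : List MC} :
    EnclC S f L ↔ ∀ i < L.length, MC.mem S (f i) (L.getD i zeroC) := by
  induction L generalizing f with
  | nil => simp [EnclC]
  | cons Z L ih =>
    show (MC.mem S (f 0) Z ∧ EnclC S (fun i ↦ f (i + 1)) L) ↔ _
    rw [ih]
    constructor
    · rintro ⟨h0, h⟩ i hi
      cases i with
      | zero => simpa using h0
      | succ i => simpa using h i (by simpa using hi)
    · intro h
      exact ⟨by simpa using h 0 (by simp), fun i hi ↦ by simpa using h (i + 1) (by simpa using hi)⟩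

/-- Entry access. -/
theorem EnclC.getD {f : ℕ → ℂ} {L : List MC} (h : EnclC S f L) {i : ℕ} (hi : i < L.length) :
    MC.mem S (f i) (L.getD i zeroC) := enclC_iff_getD.1 h i hi

/-- Entrywise-equal functions (on the indices of `L`) have the same enclosures. -/
theorem EnclC.congr {f g : ℕ → ℂ} {L : List MC} (h : EnclC S f L) (hfg : ∀ i < L.length, f i = g i) :
    EnclC S g L :=
  enclC_iff_getD.2 fun i hi ↦ hfg i hi ▸ h.getD hi

/-- Pointwise-equal functions have the same enclosures. -/
theorem EnclC.congr' {f g : ℕ → ℂ} {L : List MC} (h : EnclC S f L) (hfg : ∀ i, f i = g i) :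
    EnclC S g L := h.congr fun i _ ↦ hfg i

/-- A list of zero boxes encloses the zero function. -/
theorem enclC_replicate_zeroC (S n : ℕ) : EnclC S (fun _ ↦ (0 : ℂ)) (List.replicate n zeroC) := by
  induction n with
  | zero => trivial
  | succ n ih => exact ⟨mem_zeroC S, ih⟩

/-- Dropping the head shifts the enclosed function. -/
theorem enclC_tail {f : ℕ → ℂ} {L : List MC} (h : EnclC S f L) : EnclC S (fun j ↦ f (j + 1)) L.tail := by
  cases L with
  | nil => trivial
  | cons Z L => exact h.2

/-- Length of `addLC`. -/
@[simp] theorem length_addLC (L M : List MC) : (addLC L M).length = min L.length M.length := by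
  simp [addLC]

/-- `addLC` encloses the sum. -/
theorem enclC_addLC {f g : ℕ → ℂ} {L M : List MC} (hf : EnclC S f L) (hg : EnclC S g M) :
    EnclC S (fun i ↦ f i + g i) (addLC L M) := by
  induction L generalizing f g M with
  | nil => simp [addLC]
  | cons Z L ih =>
    cases M with
    | nil => simp [addLC]
    | cons W M => exact ⟨MC.mem_add hf.1 hg.1, ih hf.2 hg.2⟩

/-- `dotC` encloses the dot product over the common prefix. -/
theorem mem_dotC (hS : 0 < S) {a b : ℕ → ℂ} {G T : List MC} (ha : EnclC S a G) (hb : EnclC S b T) :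
    MC.mem S (∑ l ∈ range (min G.length T.length), a l * b l) (dotC S G T) := by
  induction G generalizing a b T with
  | nil => simpa [dotC] using mem_zeroC S
  | cons g G ih =>
    cases T with
    | nil => simpa [dotC] using mem_zeroC S
    | cons t T =>
      simp only [dotC, List.length_cons, Nat.succ_min_succ]
      rw [sum_range_succ']
      simpa [add_comm] using MC.mem_add (MC.mem_mul hS ha.1 hb.1) (ih ha.2 hb.2)

/-- Scaling a real list by a complex box. -/
theorem enclC_map_mulMI (hS : 0 < S) {v : ℂ} {V : MC} (hv : MC.mem S v V) {f : ℕ → ℝ} {C : List MI}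
    (hf : Encl S f C) : EnclC S (fun i ↦ v * f i) (C.map fun c ↦ MC.mulMI S V c) := by
  induction C generalizing f with
  | nil => trivial
  | cons c C ih =>
    refine ⟨?_, ih hf.2⟩
    have := MC.mem_mulMI hS hv hf.1
    simpa using this

/-- Real parts. -/
theorem encl_map_re {f : ℕ → ℂ} {L : List MC} (h : EnclC S f L) :
    Encl S (fun i ↦ (f i).re) (L.map MC.re) := by
  induction L generalizing f with
  | nil => trivial
  | cons Z L ih => exact ⟨h.1.1, ih h.2⟩

/-- Length of `widenPassC`. -/
@[simp] theorem length_widenPassC (S : ℕ) : ∀ (P : List MC) (e rinv : ℚ),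
    (widenPassC S P e rinv).length = P.length
  | [], _, _ => rfl
  | p :: P, e, rinv => by simp [widenPassC, length_widenPassC]

/-- `widenPassC` turns enclosures of `p` into enclosures of `u` when `‖u i − p i‖ ≤ e·rinvⁱ`. -/
theorem enclC_widenPassC (S : ℕ) : ∀ (P : List MC) (p u : ℕ → ℂ) (e rinv : ℚ),
    EnclC S p P → (∀ i < P.length, ‖u i - p i‖ ≤ ((e * rinv ^ i : ℚ) : ℝ)) →
    EnclC S u (widenPassC S P e rinv)
  | [], _, _, _, _, _, _ => trivial
  | I :: P, p, u, e, rinv, hP, herr => by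
    simp only [widenPassC]
    refine ⟨?_, ?_⟩
    · refine MC.mem_widen hP.1 ?_
      have h0 := herr 0 (by simp)
      simp only [pow_zero, mul_one] at h0
      have hS0 : (0 : ℝ) ≤ S := by positivity
      have : ‖u 0 - p 0‖ * S ≤ (e : ℝ) * S := mul_le_mul_of_nonneg_right h0 hS0
      exact_mod_cast this.trans (le_ceilScaled S e)
    · refine enclC_widenPassC S P (fun i ↦ p (i + 1)) (fun i ↦ u (i + 1)) (e * rinv) rinv hP.2 ?_
      intro i hi
      have := herr (i + 1) (by simpa using hi)
      simpa [pow_succ, mul_assoc, mul_comm, mul_left_comm] using this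

/-- Reversal. -/
theorem enclC_reverse {f : ℕ → ℂ} {L : List MC} (h : EnclC S f L) :
    EnclC S (fun i ↦ f (L.length - 1 - i)) L.reverse := by
  rw [enclC_iff_getD] at h ⊢
  intro i hi
  rw [List.length_reverse] at hi
  have := h (L.length - 1 - i) (by omega)
  rw [List.getD_eq_getElem?_getD, List.getElem?_reverse hi, ← List.getD_eq_getElem?_getD]
  exact this

/-! ## Logarithms from a checked factorisation -/

/-- `logNatWith` encloses `log n` (given a box of `log 2`). -/
theorem logNatWith_spec (hS : 0 < S) {K : ℕ} {L2 : MI} (hL2 : MI.mem S (Real.log 2) L2) {n : ℕ} {Y : MI}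
    (h : logNatWith S K L2 n = some Y) : MI.mem S (Real.log n) Y := by
  unfold logNatWith at h
  split_ifs at h with hn
  simp only at h
  split at h
  · rename_i Z hZ
    simp only [Option.some.injEq] at h
    subst h
    set k := Nat.log 2 n with hk
    have hn1 : 1 ≤ n := Nat.one_le_iff_ne_zero.2 hn
    have hnr : (0 : ℝ) < n := by exact_mod_cast hn1
    have h3 := MI.mem_logOneSub hS hZ (MI.mem_ofFrac S ((n : ℤ) - (2 : ℤ) ^ k) (q := n) hn1)
    have e1 : (1 : ℝ) - (((n : ℤ) - (2 : ℤ) ^ k : ℤ) : ℝ) / (n : ℕ) = (2 : ℝ) ^ k / n := by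
      push_cast
      field_simp
      ring
    rw [e1, Real.log_div (by positivity) hnr.ne', Real.log_pow] at h3
    have := MI.mem_sub (MI.mem_mulInt hL2 (k : ℤ)) h3
    convert this using 1
    push_cast
    ring
  · simp at h

/-- Every entry `(p, Y)` of `primeLogs … ps` has `Y ∋ log p`. -/
theorem primeLogs_spec (hS : 0 < S) {K : ℕ} {L2 : MI} (hL2 : MI.mem S (Real.log 2) L2) :
    ∀ (ps : List ℕ) (PL : List (ℕ × MI)), primeLogs S K L2 ps = some PL →
      ∀ t ∈ PL, MI.mem S (Real.log t.1) t.2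
  | [], PL, h => by
    simp only [primeLogs, Option.some.injEq] at h
    subst h; simp
  | p :: ps, PL, h => by
    simp only [primeLogs] at h
    split at h
    · rename_i y rest hy hrest
      simp only [Option.some.injEq] at h
      subst h
      intro t ht
      rcases List.mem_cons.1 ht with rfl | ht
      · exact logNatWith_spec hS hL2 hy
      · exact primeLogs_spec hS hL2 ps rest hrest t ht
    · simp at h

/-- `lookupLog` encloses `log p` when `p` is in the table. -/
theorem lookupLog_spec {PL : List (ℕ × MI)} (hPL : ∀ t ∈ PL, MI.mem S (Real.log t.1) t.2) {p : ℕ}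
    (hp : (PL.any fun t ↦ t.1 == p) = true) : MI.mem S (Real.log p) (lookupLog PL p) := by
  unfold lookupLog
  split
  · rename_i e he
    have h1 : e.1 = p := by simpa using List.find?_some he
    rw [← h1]
    exact hPL e (List.mem_of_find?_eq_some he)
  · rename_i he
    exfalso
    rw [List.find?_eq_none] at he
    obtain ⟨t, ht, htp⟩ := List.any_eq_true.1 hp
    exact he t ht htp

/-- `logOfFac` encloses the logarithm of the product of the factorisation (when it is non-zero and all bases
are tabulated). -/
theorem logOfFac_spec {PL : List (ℕ × MI)} (hPL : ∀ t ∈ PL, MI.mem S (Real.log t.1) t.2) :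
    ∀ f : List (ℕ × ℕ), (f.all fun e ↦ PL.any fun t ↦ t.1 == e.1) = true →
      (f.map fun e ↦ e.1 ^ e.2).prod ≠ 0 →
      MI.mem S (Real.log (((f.map fun e ↦ e.1 ^ e.2).prod : ℕ) : ℝ)) (logOfFac PL f)
  | [], _, _ => by simpa [logOfFac] using mem_zeroI S
  | e :: f, hall, hne => by
    rw [List.all_cons, Bool.and_eq_true] at hall
    rw [List.map_cons, List.prod_cons] at hne ⊢
    have hne1 : e.1 ^ e.2 ≠ 0 := fun h ↦ hne (by rw [h, zero_mul])
    have hne2 : (f.map fun e ↦ e.1 ^ e.2).prod ≠ 0 := fun h ↦ hne (by rw [h, mul_zero])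
    have ih := logOfFac_spec hPL f hall.2 hne2
    have hlog := lookupLog_spec hPL hall.1
    have := MI.mem_add ih (MI.mem_mulInt hlog (e.2 : ℤ))
    simp only [logOfFac, List.foldr_cons] at this ⊢
    convert this using 2
    rw [Nat.cast_mul, Real.log_mul (by exact_mod_cast hne1) (by exact_mod_cast hne2), Nat.cast_pow,
      Real.log_pow]
    push_cast
    ring

/-- **The logarithm table**: if `logsFromFacs PL m₀ facs = some Ls` (every factorisation checked) then
`Ls[i] ∋ log (m₀ + 1 + i)` and `Ls.length = facs.length`. -/
theorem logsFromFacs_spec {PL : List (ℕ × MI)} (hPL : ∀ t ∈ PL, MI.mem S (Real.log t.1) t.2) :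
    ∀ (facs : List (List (ℕ × ℕ))) (m₀ : ℕ) (Ls : List MI), logsFromFacs PL m₀ facs = some Ls →
      Ls.length = facs.length ∧ Encl S (fun i ↦ Real.log ((m₀ + 1 + i : ℕ) : ℝ)) Ls
  | [], m₀, Ls, h => by
    simp only [logsFromFacs, Option.some.injEq] at h
    subst h; exact ⟨rfl, trivial⟩
  | f :: fs, m₀, Ls, h => by
    simp only [logsFromFacs] at h
    split_ifs at h with hok
    split at h
    · rename_i rest hrest
      simp only [Option.some.injEq] at h
      subst h
      obtain ⟨hl, he⟩ := logsFromFacs_spec hPL fs (m₀ + 1) rest hrest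
      rw [facOK, Bool.and_eq_true, decide_eq_true_eq] at hok
      refine ⟨by simp [hl], ?_, he.congr' fun i ↦ by
        simp only [show m₀ + 1 + 1 + i = m₀ + 1 + (i + 1) by omega]⟩
      have h0 := logOfFac_spec hPL f hok.2 (by rw [hok.1]; omega)
      rw [hok.1] at h0
      simpa using h0
    · simp at h

end Summit.RiemannHypothesis.RiemannHypothesis.Theorems.LiDirichletKernel
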